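import Literature.AlgebraicGeometry.Frobenioids.Thm34ConsequencesAsPrinted
import Literature.AlgebraicGeometry.Frobenioids.Cor411iAsPrinted
import Literature.AlgebraicGeometry.Frobenioids.DivisorMonoidCategoryTheoreticityCor411ivAsPrinted
import Literature.AlgebraicGeometry.Frobenioids.DivisorMonoidCategoryTheoreticityCor411ivRigidHolds
import Literature.AlgebraicGeometry.Frobenioids.BirationalizationProp44
import Literature.AlgebraicGeometry.Frobenioids.BirationalizationProp44General
import Literature.AlgebraicGeometry.Frobenioids.BirationalizationProp44UnitsProofs
import Literature.AlgebraicGeometry.Frobenioids.BaseSectionsOfObjectsCor57NonVacuity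
import Literature.AlgebraicGeometry.Frobenioids.ArithmeticFrobenioidFrobeniusCompact
import Literature.AlgebraicGeometry.Frobenioids.ArithmeticFrobenioidIsotropic
import HarnessLib

/-!
# Frobenioids I, §4 (Prop. 4.4 (ii)–(iv), Cor. 4.10, Cor. 4.11 (i), (iii) compatibility, (iv) rigidity) AT THE
# arithmetic Frobenioids `C_{K/F}` of Example 6.3 — hypothesis-free instance forms

Mochizuki, *The geometry of Frobenioids I: the general theory*, Kyushu J. Math. **62** (2008) 293–400, §4:
Prop. 4.4 pp. 82–83, Cor. 4.10 pp. 90–91, Cor. 4.11 pp. 91–92 (proof pp. 92–94); Ex. 6.3 / Thm. 6.4 (i) pp. 113–115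
("`C` [= `C_{K/F}`] is of isotropic and rationally standard type, but not of group-like type … `D` is … Div-slim").
[cite: MochizukiFrdI2008, Cor. 4.11 p.91] [cite: MochizukiFrdI2008, Cor. 4.10 p.90] [cite: MochizukiFrdI2008, Prop. 4.4 p.83]
[cite: MochizukiFrdI2008, Thm. 6.4 (i) p.114]

PROOF-ONLY companion (cell abc-iut, D-0079 L-F [FrdI/II] pack C, seat abc-iut-L1-t3 gen 6 = the typer of the §4 schemas
`PreFrobenioidData.Cor410 / Cor411i / Cor411iii_compat / Cor411ivRigid / Prop44ii / Prop44iii / Prop44iv`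
(`DivisorMonoidCategoryTheoreticity{,Defs}.lean`); 0 `def`, no instance, no notation, no named fact).  The §4 schemas
are typed over bare pre-Frobenioid operations, so their universal closures are false (`…SchemaNegative…` files);
print states them for FROBENIOIDS with perf-factorial divisor monoids (§4 standing assumptions, p. 75), and in that
generality they are theorems of the tree (`PreFrobenioid.cor410_biratData_asPrinted`, `PreFrobenioid.cor411i_ofFunctor`,
`FrdI.cor411ii/iii/iv_ofFunctor`, `PreFrobenioid.cor411iii_compat_holds_asPrinted`, `PreFrobenioid.cor411ivRigid_of_baseIso`,
`FrdI.T49.thm49_rsParams`, `PreFrobenioid.prop44ii/iv_holds_of_isFrobenioid`, `PreFrobenioid.prop44iii_holds_of_isFrobenioid`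
(isotropic type — the typed 2008 wording of Prop. 4.4 (iii) is refuted at the two-level Frobenioid,
`TwoLevel.not_prop44iii_biratData_canonical`)).  This file records the corresponding HYPOTHESIS-FREE instance forms at
the GENUINE carrier of [IUTchI]'s number-field Frobenioids, THE arithmetic Frobenioids `C_{K/F}` (a `ModelFrobenioid`,
abc-iut-L6-t10's `arithFrobenioid`), where the standing assumptions are theorems (`arithFrobenioid_isFrobenioid`,
`arith_objectwise_isPerfFactorial`, `cor411Setting_arith`, `isOfIsotropicType_arith`, `not_isOfGroupLikeType_arith`,
`arithFrobenioid_isOfRationallyStandardType_rsParams`) — companions of the already-landed `cor411ii_arith`,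
`cor411iii_arith`, `cor411iv_arith` (abc-iut-L1-d1/t14), `FrdI.T49.thm49_arith_rsParams` / `exists_thm49_compat_arith`
(abc-iut-w4-d109).  Everything is ONE application of a landed theorem; nothing printed is strengthened.  Honest
framing: kernel bookkeeping for a refereed 2008 statement; nothing here bears on, or takes a side on, [IUTchIII]
Cor. 3.12; typed ≠ proved-in-print.
-/

namespace Literature.AlgebraicGeometry.Frobenioids

open CategoryTheory Opposite

section Arith

variable {F₁ : Type} [Field F₁] [NumberField F₁] {K₁ : Type} [Field K₁] [Algebra F₁ K₁] [IsGalois F₁ K₁]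
  {F₂ : Type} [Field F₂] [NumberField F₂] {K₂ : Type} [Field K₂] [Algebra F₂ K₂] [IsGalois F₂ K₂]

/-! ### Prop. 4.4 (ii)–(iv) at THE birationalization of `C_{K/F}` -/

variable (F₁ K₁) in
/-- **[FrdI] Prop. 4.4 (ii) AS TYPED (`Prop44ii`) at THE birationalization of `C_{K/F}`** (hypothesis-free:
`C_{K/F}` is a Frobenioid, Ex. 6.3). [cite: MochizukiFrdI2008, Prop. 4.4 (ii) p.83] -/
theorem prop44ii_arith :
    PreFrobenioidData.Prop44ii (PreFrobenioid.biratData (arithFrobenioid_isFrobenioid F₁ K₁)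
      (PreFrobenioid.hasBiratSquares_of_isFrobenioid (arithFrobenioid_isFrobenioid F₁ K₁))) :=
  PreFrobenioid.prop44ii_holds_of_isFrobenioid (arithFrobenioid_isFrobenioid F₁ K₁)

variable (F₁ K₁) in
/-- **[FrdI] Prop. 4.4 (iii) AS TYPED (`Prop44iii`, 2008 wording) at THE birationalization of `C_{K/F}`** —
hypothesis-free, because `C_{K/F}` is of ISOTROPIC type (Thm. 6.4 (i); abc-iut-L1-t2/L6-t10's
`isOfIsotropicType_arith`), the case in which the typed (iii) holds (`PreFrobenioid.prop44iii_holds_of_isFrobenioid`);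
for a general Frobenioid the typed (iii) is refuted (`TwoLevel.not_prop44iii_biratData_canonical`, cf. the author's
2024 Comments (29)(i)). [cite: MochizukiFrdI2008, Prop. 4.4 (iii) p.83] -/
theorem prop44iii_arith :
    PreFrobenioidData.Prop44iii (PreFrobenioid.biratData (arithFrobenioid_isFrobenioid F₁ K₁)
      (PreFrobenioid.hasBiratSquares_of_isFrobenioid (arithFrobenioid_isFrobenioid F₁ K₁))) :=
  PreFrobenioid.prop44iii_holds_of_isFrobenioid (arithFrobenioid_isFrobenioid F₁ K₁)
    ((PreFrobenioidData.ofFunctor_isOfIsotropicType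
      (ModelFrobenioid.toElem (arithDivisorFunctor F₁ K₁) (unitsFunctor F₁ K₁) (divNatTrans F₁ K₁))).mp
      (isOfIsotropicType_arith F₁ K₁))

variable (F₁ K₁) in
/-- **[FrdI] Prop. 4.4 (iv) AS TYPED (`Prop44iv`) at THE birationalization of `C_{K/F}`** (hypothesis-free).
[cite: MochizukiFrdI2008, Prop. 4.4 (iv) p.83] -/
theorem prop44iv_arith :
    PreFrobenioidData.Prop44iv (PreFrobenioid.biratData (arithFrobenioid_isFrobenioid F₁ K₁)
      (PreFrobenioid.hasBiratSquares_of_isFrobenioid (arithFrobenioid_isFrobenioid F₁ K₁))) :=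
  PreFrobenioid.prop44iv_holds_of_isFrobenioid (arithFrobenioid_isFrobenioid F₁ K₁)

/-! ### Cor. 4.10 at THE birationalizations of `C_{K₁/F₁}`, `C_{K₂/F₂}` -/

/-- **[FrdI] Cor. 4.10 AS TYPED (`Cor410`) for EVERY equivalence `Ψ : C_{K₁/F₁} ⥲ C_{K₂/F₂}` of arithmetic
Frobenioids, at THE birationalizations** (hypothesis-free; abc-iut-L1-t13's `PreFrobenioid.cor410_biratData_asPrinted`
— its antecedents "FSMFF-type", "quasi-isotropic" are consumed, the composition squares are the canonical ones of a
Frobenioid). [cite: MochizukiFrdI2008, Cor. 4.10 p.90] -/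
theorem cor410_arith (Ψ : arithFrobenioid F₁ K₁ ≌ arithFrobenioid F₂ K₂) :
    (arithFrobenioidOps F₁ K₁).Cor410 (arithFrobenioidOps F₂ K₂) Ψ
      (PreFrobenioid.biratData (arithFrobenioid_isFrobenioid F₁ K₁)
        (PreFrobenioid.hasBiratSquares_of_isFrobenioid (arithFrobenioid_isFrobenioid F₁ K₁)))
      (PreFrobenioid.biratData (arithFrobenioid_isFrobenioid F₂ K₂)
        (PreFrobenioid.hasBiratSquares_of_isFrobenioid (arithFrobenioid_isFrobenioid F₂ K₂))) :=
  PreFrobenioid.cor410_biratData_asPrinted (arithFrobenioid_isFrobenioid F₁ K₁)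
    (PreFrobenioid.hasBiratSquares_of_isFrobenioid (arithFrobenioid_isFrobenioid F₁ K₁))
    (arithFrobenioid_isFrobenioid F₂ K₂)
    (PreFrobenioid.hasBiratSquares_of_isFrobenioid (arithFrobenioid_isFrobenioid F₂ K₂)) Ψ

/-! ### Cor. 4.11 (i) at `C_{K/F}`: THE restriction `Ψ^istr` and the typed (i) for it -/

/-- **[FrdI] Cor. 4.11 (i) AS TYPED (`Cor411i`) for EVERY equivalence `Ψ : C_{K₁/F₁} ⥲ C_{K₂/F₂}`**
(hypothesis-free): THE restriction `Ψ^istr : C₁^istr ⥲ C₂^istr` of `Ψ` to the isotropic objects (Thm. 3.4 (i)),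
characterised by `Ψ^istr ⋙ (C₂^istr ⊆ C₂) = (C₁^istr ⊆ C₁) ⋙ Ψ`, exists, and the typed Cor. 4.11 (i) holds for it
(a `1`-unique `Ψ^un-tr` `1`-commuting with the unit-trivialisations, both composites rigid) — abc-iut-L1-t14's
`PreFrobenioid.cor411i_ofFunctor` at the data (`cor411Setting_arith`). [cite: MochizukiFrdI2008, Cor. 4.11 (i) p.91] -/
theorem exists_cor411i_arith (Ψ : arithFrobenioid F₁ K₁ ≌ arithFrobenioid F₂ K₂) :
    ∃ Ψistr : (arithFrobenioidOps F₁ K₁).Istr ≌ (arithFrobenioidOps F₂ K₂).Istr,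
      Ψistr.functor ⋙ (arithFrobenioidOps F₂ K₂).istrι = (arithFrobenioidOps F₁ K₁).istrι ⋙ Ψ.functor ∧
        (arithFrobenioidOps F₁ K₁).Cor411i (arithFrobenioidOps F₂ K₂) Ψ Ψistr.functor :=
  PreFrobenioid.cor411i_ofFunctor (arithFrobenioid_isFrobenioid F₁ K₁) (arithFrobenioid_isFrobenioid F₂ K₂)
    (arith_objectwise_isPerfFactorial F₁ K₁) (arith_objectwise_isPerfFactorial F₂ K₂) Ψ
    (cor411Setting_arith F₁ K₁ F₂ K₂ Ψ)

/-! ### Cor. 4.11 (iii), compatibility clause, at `C_{K/F}` -/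

/-- **[FrdI] Cor. 4.11 (iii) WITH its compatibility clause AS TYPED (`Cor411iii_compat`, `Thm49_compat`) for EVERY
equivalence `Ψ : C_{K₁/F₁} ⥲ C_{K₂/F₂}`** — hypothesis-free: `C_{K/F}` is of isotropic, rationally standard and not
group-like type (Thm. 6.4 (i), the proviso of the clause) and the Cor. 4.11 hypotheses hold (`cor411Setting_arith`).
THE `Ψ^Prime = e` of Thm. 4.2 (ii), THE `Ψ^Φ = E` of Thm. 4.9 with its divisor clause on pre-steps and
`Thm49_compat E e`, THE `1`-unique `Ψ^Base` of (ii) with `η`, the descended `Ψ^Φ'` on `D₁` over `Ψ^Base` and the induced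
bijections of primes `e'`, for which the typed `Cor411iii_compat Ψ^Φ' e'` holds — abc-iut-f-027's
`PreFrobenioid.cor411iii_compat_holds_asPrinted` at the data. [cite: MochizukiFrdI2008, Cor. 4.11 (iii) p.92] -/
theorem exists_cor411iii_compat_arith (Ψ : arithFrobenioid F₁ K₁ ≌ arithFrobenioid F₂ K₂) :
    ∃ (e : ∀ A : arithFrobenioid F₁ K₁,
        Primes ((arithDivisorFunctor F₁ K₁).obj (op (PreFrobenioid.baseObj
          (ModelFrobenioid.toElem (arithDivisorFunctor F₁ K₁) (unitsFunctor F₁ K₁) (divNatTrans F₁ K₁)) A))) ≃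
        Primes ((arithDivisorFunctor F₂ K₂).obj (op (PreFrobenioid.baseObj
          (ModelFrobenioid.toElem (arithDivisorFunctor F₂ K₂) (unitsFunctor F₂ K₂) (divNatTrans F₂ K₂))
            (Ψ.functor.obj A)))))
      (E : (arithFrobenioidOps F₁ K₁).DivisorMonoidIsoOver (arithFrobenioidOps F₂ K₂) Ψ)
      (ΨBase : FinSubextCat F₁ K₁ ⥤ FinSubextCat F₂ K₂)
      (η : Ψ.functor ⋙ (arithFrobenioidOps F₂ K₂).base ≅ (arithFrobenioidOps F₁ K₁).base ⋙ ΨBase)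
      (E' : (arithFrobenioidOps F₁ K₁).DivisorMonoidIsoOverBase (arithFrobenioidOps F₂ K₂) ΨBase)
      (e' : ∀ X : FinSubextCat F₁ K₁,
        Primes ((arithDivisorFunctor F₁ K₁).obj (op X)) ≃ Primes ((arithDivisorFunctor F₂ K₂).obj (op (ΨBase.obj X)))),
      (∀ (A : arithFrobenioid F₁ K₁) (𝔭 : Primes ((arithDivisorFunctor F₁ K₁).obj (op (PreFrobenioid.baseObj
          (ModelFrobenioid.toElem (arithDivisorFunctor F₁ K₁) (unitsFunctor F₁ K₁) (divNatTrans F₁ K₁)) A)))),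
        (∀ ⦃B : arithFrobenioid F₁ K₁⦄ (φ : A ⟶ B),
            PreFrobenioid.IsCoAngularPreStep
              (ModelFrobenioid.toElem (arithDivisorFunctor F₁ K₁) (unitsFunctor F₁ K₁) (divNatTrans F₁ K₁)) φ →
            (PreFrobenioid.Div
                (ModelFrobenioid.toElem (arithDivisorFunctor F₁ K₁) (unitsFunctor F₁ K₁) (divNatTrans F₁ K₁)) φ ∈
                  𝔭.submonoid ↔
              PreFrobenioid.Div
                (ModelFrobenioid.toElem (arithDivisorFunctor F₂ K₂) (unitsFunctor F₂ K₂) (divNatTrans F₂ K₂))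
                  (Ψ.functor.map φ) ∈ (e A 𝔭).submonoid)) ∧
        ∀ ⦃B : arithFrobenioid F₁ K₁⦄ (ψ : B ⟶ A),
          PreFrobenioid.IsCoAngularPreStep
              (ModelFrobenioid.toElem (arithDivisorFunctor F₁ K₁) (unitsFunctor F₁ K₁) (divNatTrans F₁ K₁)) ψ →
          ((∃ y ∈ 𝔭.submonoid, Frobenioids.pull (arithDivisorFunctor F₁ K₁)
              (PreFrobenioid.Base
                (ModelFrobenioid.toElem (arithDivisorFunctor F₁ K₁) (unitsFunctor F₁ K₁) (divNatTrans F₁ K₁)) ψ) y =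
              PreFrobenioid.Div
                (ModelFrobenioid.toElem (arithDivisorFunctor F₁ K₁) (unitsFunctor F₁ K₁) (divNatTrans F₁ K₁)) ψ) ↔
            ∃ y ∈ (e A 𝔭).submonoid, Frobenioids.pull (arithDivisorFunctor F₂ K₂)
              (PreFrobenioid.Base
                (ModelFrobenioid.toElem (arithDivisorFunctor F₂ K₂) (unitsFunctor F₂ K₂) (divNatTrans F₂ K₂))
                  (Ψ.functor.map ψ)) y =
              PreFrobenioid.Div
                (ModelFrobenioid.toElem (arithDivisorFunctor F₂ K₂) (unitsFunctor F₂ K₂) (divNatTrans F₂ K₂))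
                  (Ψ.functor.map ψ))) ∧
      (∀ ⦃A B : arithFrobenioid F₁ K₁⦄ (φ : A ⟶ B),
        PreFrobenioid.IsPreStep
            (ModelFrobenioid.toElem (arithDivisorFunctor F₁ K₁) (unitsFunctor F₁ K₁) (divNatTrans F₁ K₁)) φ →
          E.iso A (PreFrobenioid.Div
            (ModelFrobenioid.toElem (arithDivisorFunctor F₁ K₁) (unitsFunctor F₁ K₁) (divNatTrans F₁ K₁)) φ) =
            PreFrobenioid.Div
              (ModelFrobenioid.toElem (arithDivisorFunctor F₂ K₂) (unitsFunctor F₂ K₂) (divNatTrans F₂ K₂))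
              (Ψ.functor.map φ)) ∧
      (arithFrobenioidOps F₁ K₁).Thm49_compat (arithFrobenioidOps F₂ K₂) Ψ E e ∧
      PreFrobenioidData.OneUniqueSquare Ψ.functor (arithFrobenioidOps F₁ K₁).base (arithFrobenioidOps F₂ K₂).base
        ΨBase ∧
      (∀ (A : arithFrobenioid F₁ K₁) (x : (arithDivisorFunctor F₁ K₁).obj (op (PreFrobenioid.baseObj
          (ModelFrobenioid.toElem (arithDivisorFunctor F₁ K₁) (unitsFunctor F₁ K₁) (divNatTrans F₁ K₁)) A))),
        E'.iso (PreFrobenioid.baseObj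
          (ModelFrobenioid.toElem (arithDivisorFunctor F₁ K₁) (unitsFunctor F₁ K₁) (divNatTrans F₁ K₁)) A) x =
          Frobenioids.pull (arithDivisorFunctor F₂ K₂) (η.inv.app A) (E.iso A x)) ∧
      (arithFrobenioidOps F₁ K₁).Cor411iii_compat (arithFrobenioidOps F₂ K₂) E' e' :=
  PreFrobenioid.cor411iii_compat_holds_asPrinted (arithFrobenioid_isFrobenioid F₁ K₁)
    (arithFrobenioid_isFrobenioid F₂ K₂) (arith_objectwise_isPerfFactorial F₁ K₁)
    (arith_objectwise_isPerfFactorial F₂ K₂) Ψ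
    (isOfIsotropicType_arith F₁ K₁)
    (isOfIsotropicType_arith F₂ K₂)
    (not_isOfGroupLikeType_arith F₁ K₁) (not_isOfGroupLikeType_arith F₂ K₂)
    (arithFrobenioid_isOfRationallyStandardType_rsParams F₁ K₁) (cor411Setting_arith F₁ K₁ F₂ K₂ Ψ)

/-! ### Cor. 4.11 (iv), rigidity clause, at `C_{K/F}` -/

/-- **[FrdI] Cor. 4.11 (iv), rigidity clause AS TYPED (`Cor411ivRigid`) for EVERY equivalence
`Ψ : C_{K₁/F₁} ⥲ C_{K₂/F₂}`, EVERY `Ψ^Base : D₁ → D₂` making the square of (ii) `1`-commute and EVERY family of monoid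
isomorphisms `Ψ^Φ : Φ₁ ⥲ Φ₂ ∘ Ψ^Base` natural in pull-backs** (in particular THE data of Cor. 4.11 (ii)–(iv)):
hypothesis-free at `C_{K/F}` — abc-iut-f-027's `PreFrobenioid.cor411ivRigid_holds_of_oneCommutes`.
[cite: MochizukiFrdI2008, Cor. 4.11 (iv) p.92] -/
theorem cor411ivRigid_arith (Ψ : arithFrobenioid F₁ K₁ ≌ arithFrobenioid F₂ K₂)
    (ΨBase : FinSubextCat F₁ K₁ ⥤ FinSubextCat F₂ K₂)
    (hΨBase : OneCommutes Ψ.functor (arithFrobenioidOps F₂ K₂).base (arithFrobenioidOps F₁ K₁).base ΨBase)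
    (E : (arithFrobenioidOps F₁ K₁).DivisorMonoidIsoOverBase (arithFrobenioidOps F₂ K₂) ΨBase) :
    (arithFrobenioidOps F₁ K₁).Cor411ivRigid (arithFrobenioidOps F₂ K₂) Ψ ΨBase E :=
  PreFrobenioid.cor411ivRigid_holds_of_oneCommutes (arithFrobenioid_isFrobenioid F₁ K₁)
    (arithFrobenioid_isFrobenioid F₂ K₂) Ψ ΨBase hΨBase E

end Arith

end Literature.AlgebraicGeometry.Frobenioids
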